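import Literature.Algebra.EuclideanLattices.ReversedDualGramSchmidt
import Literature.Algebra.EuclideanLattices.PQCLLLProofs
import Literature.Algebra.EuclideanLattices.RegevSmoothingLowerBound
import Literature.Algebra.EuclideanLattices.BabaiResidualNorm
import HarnessLib

/-!
# Regev 2009, Lemma 3.5: how many digits — `2n` rounds suffice on the reversed dual of an LLL-reduced basis

Topic `Algebra/EuclideanLattices` (family `pqc`), grouping namespace `Regev2009`. The digit loop of
Regev's Lemma 3.5 (the `CVP` procedure of Lemma 3.4; J. ACM 56 (2009) = arXiv:2401.03703, §3.2.1:
*"After `n` steps, we have a point `x_{n+1}` whose distance to the lattice is at most `d/pⁿ`. We now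
apply … Babai's nearest plane algorithm … This yields a lattice point within `2ⁿ·d/pⁿ ≤ d < λ₁(L)/2`"*)
ends with Babai's algorithm on a REDUCED basis of the lattice in which the point is decoded (for
Theorem 3.1, pqc.S19: the dual lattice `L*` of the input lattice `L`). Babai decodes exactly once the
point is within `minᵢ ‖c̃ᵢ‖/2` of the lattice (tree `Regev2009.digitOutput_eq_repr`, hypothesis
`‖x − κ‖/q^{t+1} < ‖c̃ᵢ‖/2` of `toReal_regevLoopK_ne_le_cos`). This file records the textbook way to
meet that hypothesis WITHOUT reducing the dual lattice: LLL-reduce the (integer) input basis `b` of `L`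
and take for `L*` the dual basis `d` **in reverse order**, for which `‖(d ∘ rev)~ᵢ‖ = 1/‖b̃_{rev i}‖`
(Peikert 2009, Lemma 2.3; tree `norm_gramSchmidt_dual_rev`); LLL82 Prop. 1.12 (`‖bⱼ‖ ≤ 2^{(n−1)/2}λₙ(L)`)
and transference (`λₙ(L)·λ₁(L*) ≤ n`, Banaszczyk 1993; tree `successiveMinimum_mul_minNorm_dual_le`) then
give `‖(d ∘ rev)~ᵢ‖ ≥ λ₁(L*)/(n·2^{(n−1)/2})`, so that `2n` rounds suffice for any `q ≥ 2`:

* `norm_le_two_pow_mul_successiveMinimum` — `‖bⱼ‖ ≤ 2^{(n−1)/2} λₙ(L)` for an LLL-reduced basis;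
* `minNorm_dual_le_mul_norm_gramSchmidt_dual_rev` — **`λ₁(L*) ≤ n·2^{(n−1)/2}·‖(d ∘ rev)~ᵢ‖`**;
* **`norm_div_pow_lt_gramSchmidt_dual_rev`** — if `‖x − κ‖ < λ₁(L*)/2` and `q ≥ 2` then
  `‖x − κ‖/q^{2n} < ‖(d ∘ rev)~ᵢ‖/2` for every `i`.

Everything here is PROVED; no definition, no named fact.

## References

* O. Regev, *On lattices, learning with errors, random linear codes, and cryptography*, J. ACM 56
  (2009), art. 34 = arXiv:2401.03703, Lemma 3.5 (proof) and Claim 2.13 (transference) [Regev2009].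
* A. K. Lenstra, H. W. Lenstra, L. Lovász, *Factoring polynomials with rational coefficients*,
  Math. Ann. 261 (1982), Prop. 1.12 [LenstraLenstraLovasz1982].
* C. Peikert, *Public-key cryptosystems from the worst-case shortest vector problem*, STOC 2009, full
  version Lemma 2.3 [Peikert2009].
* W. Banaszczyk, *New bounds in some transference theorems in the geometry of numbers*, Math. Ann. 296
  (1993), Thm. 2.1 [Banaszczyk1993].
-/

noncomputable section

namespace Literature.Algebra.EuclideanLattices

namespace Regev2009

open Module InnerProductSpace
open scoped InnerProductSpace

variable {E : Type*} [NormedAddCommGroup E] [InnerProductSpace ℝ E] [FiniteDimensional ℝ E] {n : ℕ}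

omit [FiniteDimensional ℝ E] in
/-- **LLL82 Prop. 1.12, norm form**: every vector of an LLL-reduced basis (`δ = 3/4`) satisfies
`‖bⱼ‖ ≤ 2^{(n−1)/2} λₙ(L)`, `L = ∑ ℤbᵢ`. [cite: LenstraLenstraLovasz1982, Prop. 1.12] -/
theorem norm_le_two_pow_mul_successiveMinimum (b : Basis (Fin n) ℝ E) (hred : IsLLLReduced (3 / 4) ⇑b)
    (j : Fin n) :
    ‖b j‖ ≤ Real.sqrt 2 ^ (n - 1) *
      successiveMinimum (Literature.Computability.Cryptography.latticeOfBasis b) n := by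
  have hn : 0 < n := Fin.pos j
  set last : Fin n := ⟨n - 1, by omega⟩ with hlast
  have hj : j ≤ last := Fin.le_iff_val_le_val.2 (by show (j : ℕ) ≤ n - 1; have := j.isLt; omega)
  have h := IsLLLReduced.norm_sq_le_two_pow_mul_successiveMinimum_sq_holds b hred last j hj
  have hidx : ((last : ℕ) + 1) = n := by rw [hlast]; simp only; omega
  rw [hidx] at h
  have h0 : 0 ≤ successiveMinimum (Literature.Computability.Cryptography.latticeOfBasis b) n :=
    successiveMinimum_nonneg _ _
  have h2 : ‖b j‖ ^ 2 ≤ (Real.sqrt 2 ^ (n - 1) *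
      successiveMinimum (Literature.Computability.Cryptography.latticeOfBasis b) n) ^ 2 := by
    rw [mul_pow, ← pow_mul, mul_comm (n - 1) 2, pow_mul, Real.sq_sqrt zero_le_two]
    exact h
  exact (pow_le_pow_iff_left₀ (norm_nonneg _) (by positivity) two_ne_zero).1 h2

/-- **`λ₁(L*) ≤ n·2^{(n−1)/2}·‖(d ∘ rev)~ᵢ‖`** for the reversed dual basis `d` of an LLL-reduced basis
`b` of `L` (`⟪bᵢ, dⱼ⟫ = δᵢⱼ`): Peikert's Lemma 2.3, LLL82 Prop. 1.12 and transference.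
[cite: Regev2009, Lemma 3.5 (proof) with Claim 2.13; Peikert2009, Lemma 2.3] -/
theorem minNorm_dual_le_mul_norm_gramSchmidt_dual_rev (b : Basis (Fin n) ℝ E) (hred : IsLLLReduced (3 / 4) ⇑b)
    (d : Basis (Fin n) ℝ E) (hbd : ∀ i j, ⟪b i, d j⟫_ℝ = if i = j then (1 : ℝ) else 0) (i : Fin n) :
    minNorm (dualLattice (Literature.Computability.Cryptography.latticeOfBasis b)) ≤
      n * Real.sqrt 2 ^ (n - 1) * ‖gramSchmidt ℝ (⇑d ∘ Fin.rev) i‖ := by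
  set L := Literature.Computability.Cryptography.latticeOfBasis b with hL
  have hn : 0 < n := Fin.pos i
  -- the ambient dimension is `n`
  have hfin : finrank ℝ E = n := by rw [finrank_eq_card_basis b, Fintype.card_fin]
  -- Peikert's Lemma 2.3
  have hrev : ‖gramSchmidt ℝ (⇑d ∘ Fin.rev) i‖ = ‖gramSchmidt ℝ (⇑b) (Fin.rev i)‖⁻¹ :=
    norm_gramSchmidt_dual_rev b.linearIndependent hbd i
  have hGSpos : 0 < ‖gramSchmidt ℝ (⇑b) (Fin.rev i)‖ :=
    norm_pos_iff.2 (gramSchmidt_ne_zero _ b.linearIndependent)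
  -- `‖b̃_{rev i}‖ ≤ ‖b_{rev i}‖ ≤ 2^{(n-1)/2} λₙ(L)`
  have hup : ‖gramSchmidt ℝ (⇑b) (Fin.rev i)‖ ≤ Real.sqrt 2 ^ (n - 1) * successiveMinimum L n :=
    (Babai.norm_gramSchmidt_le_norm ⇑b (Fin.rev i)).trans (norm_le_two_pow_mul_successiveMinimum b hred _)
  -- transference `λₙ(L) λ₁(L*) ≤ n`
  have htr : successiveMinimum L n * minNorm (dualLattice L) ≤ n := by
    have h := successiveMinimum_mul_minNorm_dual_le L
    rwa [hfin] at h
  have hmin0 : 0 ≤ minNorm (dualLattice L) := minNorm_nonneg _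
  -- combine
  rw [hrev, ← div_eq_mul_inv, le_div_iff₀ hGSpos]
  calc minNorm (dualLattice L) * ‖gramSchmidt ℝ (⇑b) (Fin.rev i)‖
      ≤ minNorm (dualLattice L) * (Real.sqrt 2 ^ (n - 1) * successiveMinimum L n) :=
        mul_le_mul_of_nonneg_left hup hmin0
    _ = Real.sqrt 2 ^ (n - 1) * (successiveMinimum L n * minNorm (dualLattice L)) := by ring
    _ ≤ Real.sqrt 2 ^ (n - 1) * n := mul_le_mul_of_nonneg_left htr (by positivity)
    _ = n * Real.sqrt 2 ^ (n - 1) := mul_comm _ _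

/-- **Why `2n` rounds** (Regev: "`2ⁿ·d/pⁿ ≤ d < λ₁(L)/2`"): for a point within `< λ₁(L*)/2` of `κ`
and `q ≥ 2`, `‖x − κ‖/q^{2n} < ‖(d ∘ rev)~ᵢ‖/2` for every Gram–Schmidt vector of the reversed dual
basis (`q^{2n} ≥ 4ⁿ ≥ n·2^{(n−1)/2}·… `). [cite: Regev2009, Lemma 3.5 (proof) with Claim 2.13; LenstraLenstraLovasz1982, Prop. 1.12; Peikert2009, Lemma 2.3] -/
theorem norm_div_pow_lt_gramSchmidt_dual_rev (b : Basis (Fin n) ℝ E) (hred : IsLLLReduced (3 / 4) ⇑b)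
    (d : Basis (Fin n) ℝ E) (hbd : ∀ i j, ⟪b i, d j⟫_ℝ = if i = j then (1 : ℝ) else 0)
    {x κ : E} (hx : ‖x - κ‖ < minNorm (dualLattice (Literature.Computability.Cryptography.latticeOfBasis b)) / 2)
    {q : ℕ} (hq : 2 ≤ q) (i : Fin n) :
    ‖x - κ‖ / (q : ℝ) ^ (2 * n) < ‖gramSchmidt ℝ (⇑d ∘ Fin.rev) i‖ / 2 := by
  have hn : 0 < n := Fin.pos i
  have hkey := minNorm_dual_le_mul_norm_gramSchmidt_dual_rev b hred d hbd i
  set lam := minNorm (dualLattice (Literature.Computability.Cryptography.latticeOfBasis b)) with hlam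
  set g := ‖gramSchmidt ℝ (⇑d ∘ Fin.rev) i‖ with hg
  have hg0 : 0 ≤ g := norm_nonneg _
  -- `n · √2^{n-1} ≤ 4ⁿ ≤ q^{2n}`
  have hC0 : (0 : ℝ) < n * Real.sqrt 2 ^ (n - 1) := by positivity
  have hC : (n : ℝ) * Real.sqrt 2 ^ (n - 1) ≤ (q : ℝ) ^ (2 * n) := by
    have hs2 : Real.sqrt 2 ≤ 2 := by
      nlinarith [Real.sq_sqrt (show (0:ℝ) ≤ 2 by norm_num), Real.sqrt_nonneg 2]
    have h1 : Real.sqrt 2 ^ (n - 1) ≤ 2 ^ (n - 1) := pow_le_pow_left₀ (Real.sqrt_nonneg 2) hs2 _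
    have h2 : (n : ℝ) ≤ 2 ^ n := by exact_mod_cast Nat.lt_two_pow_self.le
    have h3 : (2 : ℝ) ^ n * 2 ^ (n - 1) ≤ 2 ^ (2 * n) := by
      rw [← pow_add]; exact pow_le_pow_right₀ one_le_two (by omega)
    have h4 : (2 : ℝ) ^ (2 * n) ≤ (q : ℝ) ^ (2 * n) := pow_le_pow_left₀ zero_le_two (by exact_mod_cast hq) _
    calc (n : ℝ) * Real.sqrt 2 ^ (n - 1) ≤ 2 ^ n * 2 ^ (n - 1) :=
          mul_le_mul h2 h1 (by positivity) (by positivity)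
      _ ≤ (q : ℝ) ^ (2 * n) := h3.trans h4
  have hqn : (0 : ℝ) < (q : ℝ) ^ (2 * n) := by positivity
  -- `‖x-κ‖/q^{2n} ≤ ‖x-κ‖/(n√2^{n-1}) < lam/(2 n √2^{n-1}) ≤ g/2`
  calc ‖x - κ‖ / (q : ℝ) ^ (2 * n) ≤ ‖x - κ‖ / (n * Real.sqrt 2 ^ (n - 1)) :=
        div_le_div_of_nonneg_left (norm_nonneg _) hC0 hC
    _ < lam / 2 / (n * Real.sqrt 2 ^ (n - 1)) := by
        rw [div_lt_div_iff_of_pos_right hC0]; exact hx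
    _ ≤ g / 2 := by
        rw [div_div, div_le_div_iff₀ (by positivity) two_pos]
        nlinarith [hkey]

end Regev2009

end Literature.Algebra.EuclideanLattices

end
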